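import Summits.QuantumFields.QCD.Theorems.ExtinctionBuildsQCD.Negative.WithoutTightCollapse
import Summits.QuantumFields.QCD.Theorems.ExtinctionBuildsQCD.Negative.ChiralInertia

/-!
# Negative knowledge for crux `ExtinctionBuildsQCD` (stmt-QuantumFields-8968), II: TIGHT pins the
# line into `[-8, 0]`, and TIGHT is independent of the rest of `SD`

Certified copy of §3 of the cdisprove work file
`Summits/QuantumFields/QCD/Cruxes/ExtinctionBuildsQCD/Disproof.lean` (refuter, cdisprove seat),
on top of `Negative/WithoutTightCollapse.lean` (§0–§2). Supports stmt-QuantumFields-8968; asserts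
no route item.

* Chiral inertia (Sylvester, one direction) is in `Negative/ChiralInertia.lean`
  (`countP_neg_eq_of_chiral`).
* `negCount_hermitianWilson_eq`: for EVERY `SU(3)` field on the torus of side `L` and every bare
  mass `m₀ > 0` or `m₀ < -8`, `Γ₅ D_W(U, m₀, 1)` has exactly `6 L⁴` negative eigenvalues — the
  chirality sectors `spinEmbed 0` / `spinEmbed 2` (`γ₅ = diag(1,1,-1,-1)`) carry the definite
  forms `±Re⟨v, D_W(m₀) v⟩`, `m Σ‖v‖² ≤ Re⟨v, D_W(m) v⟩ ≤ (m+8) Σ‖v‖²`.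
* `Tight.eventually_probe_mem`: the TIGHT clause forces `m_crit(k) − a_k M/Z_m(k) ∈ [-8, 0]`
  eventually, for every `M > M₀` (off that interval the TIGHT integrand is identically `0`);
  `SDHyp.line_pinned`.
* `tight_independent` (`N_f ≤ 16`): `shiftedAF` (`canonicalAF` with `m_crit ≡ 1`) is mass-scaling,
  asymptotically scaling, satisfies EXTINCT for all positive masses with `c = 1`, and FAILS TIGHT
  for every `M₀ ≥ 0` and every mass tuple: TIGHT is not a consequence of the other clauses of `SD`,
  and (with `extinctionBuildsQCDWithoutTight_iff_qcd`) it is the load-bearing one.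

References: Montvay–Münster 1994 §4.2 (γ₅-hermiticity); Edwards–Heller–Narayanan 1998 (spectral
flow of `γ₅ D_W(m)`, no crossings for `m > 0` and `m < -8`); Horn–Johnson, *Matrix Analysis*
§4.5 (Sylvester's law of inertia).
-/

noncomputable section

namespace Summit.QuantumFields.QCD.Theorems.ExtinctionBuildsQCD.Negative

open scoped BigOperators Topology Classical MeasureTheory Matrix ComplexConjugate
open Filter MeasureTheory Matrix
open Literature.MathematicalPhysics.QuantumLattice Literature.MathematicalPhysics.QuantumFieldTheory
  Literature.Probability.LatticeModels
open Summit.QuantumFields.QCD.Theses.SpectralDefectExtinction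

/-! ## §3 TIGHT pins the line into `[-8, 0]`: chiral inertia of `Γ₅ D_W(U, m₀, 1)` off the hole -/



section ChiralWilson

variable {L : ℕ} [NeZero L]

/-- Half-spinor index: site × colour × two spin components. -/
abbrev HalfIdx (L : ℕ) : Type := TorusSite 4 L × Fin 3 × Fin 2

/-- **Chiral embedding**: place a half-spinor into the spin components `o, o+1` (`o = 0`: the
`γ₅ = +1` components, `o = 2`: the `γ₅ = -1` components of `gammaFive = diag(1,1,-1,-1)`). -/
def spinEmbed (o : ℕ) : (HalfIdx L → ℂ) →ₗ[ℂ] (QuarkIdx L → ℂ) where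
  toFun c p := if h : o ≤ p.2.2.val ∧ p.2.2.val < o + 2 then
      c (p.1, p.2.1, ⟨p.2.2.val - o, by omega⟩) else 0
  map_add' c d := by
    funext p
    simp only [Pi.add_apply]
    split_ifs <;> simp
  map_smul' a c := by
    funext p
    simp only [Pi.smul_apply, smul_eq_mul, RingHom.id_apply]
    split_ifs <;> simp

omit [NeZero L] in
/-- Unfolding `spinEmbed`. -/
theorem spinEmbed_apply (o : ℕ) (c : HalfIdx L → ℂ) (p : QuarkIdx L) :
    spinEmbed o c p = if h : o ≤ p.2.2.val ∧ p.2.2.val < o + 2 then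
      c (p.1, p.2.1, ⟨p.2.2.val - o, by omega⟩) else 0 := rfl

omit [NeZero L] in
/-- The chiral embedding is injective. -/
theorem spinEmbed_ne_zero {o : ℕ} (ho : o + 2 ≤ 4) {c : HalfIdx L → ℂ} (hc : c ≠ 0) :
    spinEmbed o c ≠ 0 := by
  intro h
  apply hc
  funext q
  obtain ⟨x, a, j⟩ := q
  have hj := j.isLt
  have := congrFun h (x, a, ⟨j.val + o, by omega⟩)
  rw [spinEmbed_apply, dif_pos ⟨by simp, by simp; omega⟩] at this
  simpa using this

/-- `Γ₅` acts as `+1` on the image of the upper embedding and as `-1` on the lower one. -/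
theorem gammaFive_mulVec_spinEmbed (c : HalfIdx L → ℂ) :
    spinorLift (L := L) (N := 3) gammaFive *ᵥ spinEmbed 0 c = spinEmbed 0 c ∧
      spinorLift (L := L) (N := 3) gammaFive *ᵥ spinEmbed 2 c = -spinEmbed 2 c := by
  constructor
  · funext p
    rw [spinorLift_gammaFive_eq_diagonal, mulVec_diagonal, spinEmbed_apply]
    obtain ⟨x, a, α⟩ := p
    fin_cases α <;> simp
  · funext p
    rw [Pi.neg_apply, spinorLift_gammaFive_eq_diagonal, mulVec_diagonal, spinEmbed_apply]
    obtain ⟨x, a, α⟩ := p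
    fin_cases α <;> simp

omit [NeZero L] in
/-- `Γ₅` is Hermitian (inline, as in the barrier file). -/
theorem conjTranspose_spinorLift_gammaFive' :
    (spinorLift (L := L) (N := 3) gammaFive)ᴴ = spinorLift gammaFive := by
  rw [spinorLift_gammaFive_eq_diagonal, diagonal_conjTranspose]
  congr 1
  funext p
  obtain ⟨x, a, α⟩ := p
  fin_cases α <;> simp

/-- On a `γ₅`-eigenvector with eigenvalue `ε = ±1`, the Hermitian Wilson form is `ε Re⟨v, D v⟩`:
`⟨v, Γ₅ D v⟩ = ⟨Γ₅ v, D v⟩`. -/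
theorem form_gammaFive_mul_of_chiral (D : Matrix (QuarkIdx L) (QuarkIdx L) ℂ)
    (v : QuarkIdx L → ℂ) (ε : ℂ) (hv : spinorLift (L := L) (N := 3) gammaFive *ᵥ v = ε • v) :
    star v ⬝ᵥ ((spinorLift gammaFive * D) *ᵥ v) = (starRingEnd ℂ) ε * (star v ⬝ᵥ (D *ᵥ v)) := by
  rw [← mulVec_mulVec, dotProduct_mulVec, ← conjTranspose_conjTranspose (spinorLift gammaFive),
    ← star_mulVec, conjTranspose_spinorLift_gammaFive', hv, star_smul, smul_dotProduct,
    smul_eq_mul, Complex.star_def]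

/-- `card (HalfIdx L) = 6 L⁴`. -/
theorem card_halfIdx : Fintype.card (HalfIdx L) = 6 * L ^ 4 := by
  simp only [HalfIdx, TorusSite, Fintype.card_prod, Fintype.card_fun, ZMod.card, Fintype.card_fin]
  ring

/-- **Chiral inertia of the Hermitian Wilson operator off the hole.** For every `SU(3)` gauge
field on the torus of side `L` and every bare mass `m₀ > 0` or `m₀ < -8`, `Γ₅ D_W(U, m₀, 1)` has
EXACTLY `6 L⁴` negative eigenvalues (half of `12 L⁴`), counted as roots of the characteristic
polynomial: `Re⟨v, D_W(m₀) v⟩` has a sign on all of `ℂ^{12L⁴}` (`re_star_dotProduct_wilsonDirac_mem`),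
so `⟨v, Γ₅ D v⟩ = ±Re⟨v, Dv⟩` is definite on the two `6L⁴`-dimensional chirality sectors
(Sylvester). Hence the TIGHT integrand `|n₋ − 6(2L_k+1)⁴|` VANISHES IDENTICALLY whenever the
probe mass `m_crit(k) − a_k M/Z_k` leaves `[-8, 0]`. -/
theorem negCount_hermitianWilson_eq {m₀ : ℝ} (hm : 0 < m₀ ∨ m₀ < -8) (U : GaugeConfig 4 L SU3) :
    Multiset.countP (fun z : ℂ => z.re < 0)
      (spinorLift gammaFive * wilsonDirac (fundamentalRep (Fin 3)) U m₀ 1).charpoly.roots =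
        6 * L ^ 4 := by
  set D := wilsonDirac (fundamentalRep (Fin 3)) U m₀ 1 with hD
  have hH : (spinorLift gammaFive * D).IsHermitian :=
    Literature.Barriers.QuantumFields.isHermitian_gammaFive_mul_wilsonDirac (fundamentalRep (Fin 3))
      fundamentalRep_mem_unitaryGroup U m₀ 1
  have hcard : Fintype.card (HalfIdx L) + Fintype.card (HalfIdx L) = Fintype.card (QuarkIdx L) := by
    rw [card_halfIdx, card_quarkIdx]; ring
  -- the form on the two chiral sectors
  have hup : ∀ c : HalfIdx L → ℂ, (star (spinEmbed 0 c) ⬝ᵥ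
      ((spinorLift gammaFive * D) *ᵥ spinEmbed 0 c)).re =
        (star (spinEmbed 0 c) ⬝ᵥ (D *ᵥ spinEmbed 0 c)).re := by
    intro c
    rw [form_gammaFive_mul_of_chiral D _ 1 (by rw [one_smul]; exact (gammaFive_mulVec_spinEmbed c).1),
      map_one, one_mul]
  have hdown : ∀ c : HalfIdx L → ℂ, (star (spinEmbed 2 c) ⬝ᵥ
      ((spinorLift gammaFive * D) *ᵥ spinEmbed 2 c)).re =
        -(star (spinEmbed 2 c) ⬝ᵥ (D *ᵥ spinEmbed 2 c)).re := by
    intro c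
    rw [form_gammaFive_mul_of_chiral D _ (-1)
      (by rw [neg_one_smul]; exact (gammaFive_mulVec_spinEmbed c).2), map_neg, map_one, neg_one_mul,
      Complex.neg_re]
  rw [← card_halfIdx (L := L)]
  rcases hm with hm | hm
  · refine countP_neg_eq_of_chiral hH (spinEmbed 0) (spinEmbed 2)
      (fun c hc => ?_) (fun c hc => ?_) hcard
    · rw [hup]
      have h := (re_star_dotProduct_wilsonDirac_mem U m₀ (spinEmbed 0 c)).1
      have hN := sum_norm_sq_pos (spinEmbed_ne_zero (o := 0) (by norm_num) hc)
      nlinarith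
    · rw [hdown]
      have h := (re_star_dotProduct_wilsonDirac_mem U m₀ (spinEmbed 2 c)).1
      have hN := sum_norm_sq_pos (spinEmbed_ne_zero (o := 2) le_rfl hc)
      nlinarith
  · refine countP_neg_eq_of_chiral hH (spinEmbed 2) (spinEmbed 0)
      (fun c hc => ?_) (fun c hc => ?_) hcard
    · rw [hdown]
      have h := (re_star_dotProduct_wilsonDirac_mem U m₀ (spinEmbed 2 c)).2
      have hN := sum_norm_sq_pos (spinEmbed_ne_zero (o := 2) le_rfl hc)
      nlinarith
    · rw [hup]
      have h := (re_star_dotProduct_wilsonDirac_mem U m₀ (spinEmbed 0 c)).2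
      have hN := sum_norm_sq_pos (spinEmbed_ne_zero (o := 0) (by norm_num) hc)
      nlinarith

end ChiralWilson

section TightPins

variable {Nf : ℕ}

/-- **TIGHT forces the probes into `[-8, 0]`.** For ANY witness data, if TIGHT holds at the mass
tuple `m` then for every `M > M₀`, eventually `m_crit(k) − a_k M/Z_m(k) ∈ [-8, 0]` — off this
interval the TIGHT integrand is identically zero (`negCount_hermitianWilson_eq`), the ratio is
`0 < 1`. In particular every junk witness with the line at bare mass `≥ δ > 0` (or `≤ -8 - δ`)
infinitely often FAILS TIGHT, although it satisfies EXTINCT for free (§2). -/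
theorem Tight.eventually_probe_mem (reg : QCDRegularisation Nf) (M₀ : ℝ) (m : Fin Nf → ℝ)
    (h : Tight Nf reg M₀ m) {M : ℝ} (hM : M₀ < M) :
    ∀ᶠ k : ℕ in Filter.atTop,
      reg.mcrit k - reg.a k * M / reg.Zm k ∈ Set.Icc (-8 : ℝ) 0 := by
  filter_upwards [h M hM] with k hk
  by_contra hout
  have hout' : 0 < reg.mcrit k - reg.a k * M / reg.Zm k ∨ reg.mcrit k - reg.a k * M / reg.Zm k < -8 := by
    simp only [Set.mem_Icc, not_and_or, not_le] at hout
    tauto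
  simp only [negCount_hermitianWilson_eq hout', Nat.cast_mul, Nat.cast_pow, Nat.cast_add,
    Nat.cast_ofNat, Nat.cast_one, sub_self, abs_zero, zero_mul, integral_zero, zero_div] at hk
  exact absurd hk (by norm_num)

/-- Consequence for the full hypothesis: a spectrally clean regularisation has its line pinned,
`limsup m_crit(k) ≤ 0` and `liminf m_crit(k) ≥ -8` in the precise form below. -/
theorem SDHyp.line_pinned (h : SDHyp Nf) :
    ∃ reg : QCDRegularisation Nf, ∃ M₀ : ℝ, 0 ≤ M₀ ∧ reg.HasMassScaling ∧
      (∃ c : ℝ, 0 < c ∧ ∀ m : Fin Nf → ℝ, (∀ f, M₀ < m f) → Extinct Nf reg c m ∧ Tight Nf reg M₀ m) ∧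
      ∀ M : ℝ, M₀ < M → ∀ᶠ k : ℕ in Filter.atTop,
        reg.mcrit k - reg.a k * M / reg.Zm k ∈ Set.Icc (-8 : ℝ) 0 := by
  obtain ⟨reg, h1, -, M₀, hM₀, c, hc, h⟩ := h
  refine ⟨reg, M₀, hM₀, h1, ⟨c, hc, h⟩, fun M hM => ?_⟩
  exact Tight.eventually_probe_mem reg M₀ (fun _ => M₀ + 1) (h _ fun _ => by linarith).2 hM

end TightPins


section Independence

variable (Nf : ℕ)

/-- **Junk witness with a positive line**: the degenerate regularisation `canonicalAF` with the
line moved to bare mass `m_crit ≡ 1` (deep in the `κ < 1/8` region). -/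
def shiftedAF : QCDRegularisation Nf :=
  { QCDRegularisation.canonicalAF Nf with mcrit := fun _ => 1 }

/-- It is mass-scaling (same `Z_m`, `a` as `canonicalAF`). -/
theorem shiftedAF_hasMassScaling : (shiftedAF Nf).HasMassScaling :=
  QCDRegularisation.canonicalAF_hasMassScaling

/-- It is asymptotically scaling (same `β`, `a` as `QCDScheme.zeroAF`). -/
theorem shiftedAF_hasAsymptoticScaling : ((shiftedAF Nf).scheme 0 0 0).HasAsymptoticScaling :=
  QCDScheme.zeroAF_hasAsymptoticScaling

/-- It satisfies EXTINCT for every positive mass tuple, with `c = 1` (§2). -/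
theorem shiftedAF_extinct (m : Fin Nf → ℝ) (hm : ∀ f, 0 < m f) : Extinct Nf (shiftedAF Nf) 1 m :=
  extinct_of_mcrit_nonneg _ (fun _ => zero_le_one) le_rfl m hm

/-- Its TIGHT probes are eventually POSITIVE (for asymptotically free flavour numbers, where the
mass exponent `γ₀/(2β₀)` is non-negative so that `Z_m(k) ≥ 1`): `1 − M/((k+1) Z_m(k)) > 0`. -/
theorem shiftedAF_probe_pos (hNf : Nf ≤ 16) {M : ℝ} (hM : 0 < M) :
    ∀ᶠ k : ℕ in Filter.atTop,
      0 < (shiftedAF Nf).mcrit k - (shiftedAF Nf).a k * M / (shiftedAF Nf).Zm k := by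
  have hp : 0 ≤ massExponent Nf := by
    unfold massExponent gammaCoeff₀ betaCoeff₀
    have : (Nf : ℝ) ≤ 16 := by exact_mod_cast hNf
    apply div_nonneg (by positivity)
    apply mul_nonneg zero_le_two
    exact div_nonneg (by linarith) (by positivity)
  obtain ⟨K, hK⟩ := exists_nat_gt M
  filter_upwards [Filter.eventually_ge_atTop (max K 1)] with k hk
  have hk1 : 1 ≤ k := le_of_max_le_right hk
  have hkK : K ≤ k := le_of_max_le_left hk
  have ha : (shiftedAF Nf).a k = ((k : ℝ) + 1)⁻¹ := rfl
  have hcrit : (shiftedAF Nf).mcrit k = 1 := rfl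
  have hZ : 1 ≤ (shiftedAF Nf).Zm k := by
    show 1 ≤ (if k = 0 then (1 : ℝ) else
      Real.log (1 / (QCDScheme.zeroAF Nf).a k ^ 2) ^ massExponent Nf)
    rw [if_neg (by omega)]
    apply Real.one_le_rpow _ hp
    have hak : (QCDScheme.zeroAF Nf).a k = ((k : ℝ) + 1)⁻¹ := rfl
    rw [hak, Real.le_log_iff_exp_le (by positivity)]
    have hk2 : (2 : ℝ) ≤ (k : ℝ) + 1 := by
      have : (1 : ℝ) ≤ k := by exact_mod_cast hk1
      linarith
    calc Real.exp 1 ≤ 3 := by have := Real.exp_one_lt_d9; linarith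
      _ ≤ 1 / ((k : ℝ) + 1)⁻¹ ^ 2 := by rw [inv_pow, one_div, inv_inv]; nlinarith
  rw [ha, hcrit]
  have hkM : M < (k : ℝ) + 1 := by
    have : (K : ℝ) ≤ k := by exact_mod_cast hkK
    linarith
  have hfrac : ((k : ℝ) + 1)⁻¹ * M / (shiftedAF Nf).Zm k ≤ ((k : ℝ) + 1)⁻¹ * M :=
    div_le_self (by positivity) hZ
  have hlt : ((k : ℝ) + 1)⁻¹ * M < 1 := by
    rw [inv_mul_lt_iff₀ (by positivity)]
    linarith
  linarith

/-- **It FAILS TIGHT** for every threshold `M₀ ≥ 0` and every mass tuple (§3: TIGHT pins the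
probes into `[-8, 0]`, but here they are eventually positive). -/
theorem shiftedAF_not_tight (hNf : Nf ≤ 16) {M₀ : ℝ} (hM₀ : 0 ≤ M₀) (m : Fin Nf → ℝ) :
    ¬ Tight Nf (shiftedAF Nf) M₀ m := by
  intro h
  have h1 := Tight.eventually_probe_mem _ _ _ h (M := M₀ + 1) (by linarith)
  have h2 := shiftedAF_probe_pos Nf hNf (M := M₀ + 1) (by linarith)
  obtain ⟨k, hk1, hk2⟩ := (h1.and h2).exists
  exact absurd hk1.2 (not_le.2 hk2)

/-- **TIGHT is logically independent of the rest of `SD`** (for every asymptotically free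
`N_f ≤ 16`, in particular `N_f = 2, 3`): there is a mass-scaling, asymptotically scaling
regularisation satisfying EXTINCT for all positive masses (with `c = 1`) and failing TIGHT for
every admissible threshold and every mass tuple. Together with §2: EXTINCT ∧ scalings prove
nothing, TIGHT is the load-bearing clause, and it is not a consequence of the others. -/
theorem tight_independent (hNf : Nf ≤ 16) :
    ∃ reg : QCDRegularisation Nf, reg.HasMassScaling ∧ (reg.scheme 0 0 0).HasAsymptoticScaling ∧
      (∀ m : Fin Nf → ℝ, (∀ f, 0 < m f) → Extinct Nf reg 1 m) ∧
      ∀ M₀ : ℝ, 0 ≤ M₀ → ∀ m : Fin Nf → ℝ, ¬ Tight Nf reg M₀ m :=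
  ⟨shiftedAF Nf, shiftedAF_hasMassScaling Nf, shiftedAF_hasAsymptoticScaling Nf,
    shiftedAF_extinct Nf, fun _ hM₀ m => shiftedAF_not_tight Nf hNf hM₀ m⟩

end Independence

end Summit.QuantumFields.QCD.Theorems.ExtinctionBuildsQCD.Negative

end
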